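import Literature.NumberTheory.ComplexMultiplication.CasselmanTwistIdeleIndependence
import Literature.NumberTheory.ComplexMultiplication.ReflexTypeNormInclusion
import Literature.AlgebraicGeometry.ComplexMultiplication.ShimuraIsogeny
import Literature.AlgebraicGeometry.HodgeTheory.HodgeTypeVanishing
import Literature.AlgebraicGeometry.HodgeTheory.AbelJacobiPullbackHodgeSection
import Literature.AlgebraicGeometry.HodgeTheory.SurjectivePullbackInjective
import HarnessLib

/-!
# The CM type read on `H^{1,0}`, and the infinity type of the Shimura–Taniyama character at the base place

Layer `Literature/NumberTheory/ComplexMultiplication`.  THEOREMS ONLY (no definition, no named fact, no instance, no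
`sorry`).  Cell hodgecm-mathlib, d6 line ([Liu2021] Thm. D.6 (1), one curve), card v3.3 §2 step 4, node (J2) «CM type read
on `H^{1,0}` through the quotient» (A-plan2 (g11) 2026-08-29T19:48:52Z).

For a CM abelian variety `(A, ι)` of type `(K, Φ)` over `ℂ` read on `H¹(A(ℂ); ℂ)` — the tree's predicate
`IsCMTypeRealisation Φ A ι θ` ([Shimura1998] §5.2: the `σ`-eigenline of `θ : K → End H¹` is of Hodge type `(1,0)` for
`σ ∈ Φ`, `(0,1)` for `σ ∉ Φ`) — and for the Shimura–Taniyama characters `χ_τ` of a structure of type `(K, Φ)` over a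
number field `k ⊇ K*` (infinity type `cmInfinityType Φ τ σ₀`, [Shimura1998] Prop. 19.10 (19.10a): exponent `1` exactly at
the embeddings of the reflex type `Ψ_τ = reflexTypeOn Φ τ σ₀`):

* `IsCMTypeRealisation.mem_of_isOfHodgeType_oneZero` — a NON-ZERO `τ`-eigenvector of Hodge type `(1,0)` forces `τ ∈ Φ`
  (the type pieces `(1,0)` / `(0,1)` meet in `0`: ★ `IsOfHodgeType.eq_zero_of_ne`); dually `not_mem_of_isOfHodgeType_zeroOne`;
* `isOfHodgeType_oneZero_iff_map_of_surjective` — Hodge type `(1,0)` on `H¹` is read THROUGH a surjective homomorphism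
  `u : A → B` of abelian varieties: `v` is of type `(1,0)` on `B` iff `u^* v` is on `A` (★ `complexBetti_map_injective_of_surjective`
  [Voisin2002, Lemma 7.28] + ★ `IsOfHodgeType.of_map_of_injective` / `map_of_isSmoothProjective`);
* `starRingAut_smul_mem_reflexTypeOn_iff_of_isScalarTower` — the CM dichotomy of the reflex type on an ABSTRACT number field
  `k ⊇ K*` (`[Algebra (traceField Φ) k] [IsScalarTower (traceField Φ) k ℂ]`): `σ̄ ∈ Ψ_τ(k) ↔ σ ∉ Ψ_τ(k)` (★ intermediate-field
  form `starRingAut_smul_mem_reflexTypeOn_iff` transported by ★ `mem_reflexTypeOn_iff_comp_algebraMap_traceField_mem_of_isScalarTower`);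
* **`cmInfinityType_eq_one_zero_of_mem`** / **`cmInfinityType_eq_zero_one_of_mem`** — for `τ ∈ Φ`, the infinity type of
  `χ_τ` at an infinite place `w` of `k` is `(1, 0)` if `w.embedding = σ₀ = algebraMap k ℂ` and `(0, 1)` if
  `w.embedding = σ̄₀` ([Shimura1998] (19.10a) with `σ₀ ∈ Ψ_τ` for `τ ∈ Φ`, ★ `self_mem_reflexTypeOn`) — the ONE CALL of
  step 4 comparing the type of `ψ_lab = χ_{τ_lab}` at `w₁` with that of `μ₁ = muAlg F μ`
  (★ `hasInfinityType_muAlg_typeOfExponent`).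

HC_CM is proved only modulo the 7 printed citations until rung 0 closes; this file asserts nothing about HC.

## References
* [Shimura1998] G. Shimura, *Abelian Varieties with Complex Multiplication and Modular Functions* (1998): §5.2 (pp. 39–40),
  §13.1 (7), Prop. 19.10 (19.10a) (p. 135).
* [MilneCM2006] J. S. Milne, *Complex Multiplication* (notes), Ch. I §1 Prop. 1.23.
* [Voisin2002] C. Voisin, *Hodge Theory and Complex Algebraic Geometry I* (2002), Lemma 7.28, Cor. 6.14.
-/

set_option autoImplicit false

noncomputable section

open NumberField CategoryTheory
open Literature.AlgebraicGeometry.Motives (CMType AbelianVariety IsSmoothProjective)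
open Literature.AlgebraicGeometry.HodgeTheory
open Literature.NumberTheory.Automorphic.PicardCM (eigenline)

/-! ## §1 The CM type read on `H^{1,0}` -/

namespace Literature.AlgebraicGeometry.ComplexMultiplication

variable {K : Type} [Field K] [NumberField K] {Φ : CMType K} {A : AbelianVariety ℂ} {ι : 𝓞 K →+* End A}
  {θ : K →+* Module.End ℂ (complexBetti A.X 1)}

/-- **A non-zero `τ`-eigenvector of Hodge type `(1,0)` forces `τ ∈ Φ`**: otherwise the realisation makes it of type
`(0,1)`, and a class of both types vanishes (★ `IsOfHodgeType.eq_zero_of_ne`). [cite: Shimura1998, §5.2 (pp. 39–40)]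
[cite: Voisin2002, Cor. 6.14] -/
theorem IsCMTypeRealisation.mem_of_isOfHodgeType_oneZero (h : IsCMTypeRealisation Φ A ι θ) {τ : K →+* ℂ}
    {v : complexBetti A.X 1} (hv : v ∈ eigenline θ τ) (hv0 : v ≠ 0)
    (h10 : IsOfHodgeType (Module.finrank ℚ K / 2) A.X 1 1 0 v) : τ ∈ Φ.1 := by
  by_contra hτ
  have h01 : IsOfHodgeType (Module.finrank ℚ K / 2) A.X 1 0 1 v := (h.2.2.2 τ).2.2 hτ v hv
  exact hv0 (IsOfHodgeType.eq_zero_of_ne h.1 h10 h01 (by decide))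

/-- Dually: **a non-zero `τ`-eigenvector of Hodge type `(0,1)` forces `τ ∉ Φ`**. [cite: Shimura1998, §5.2 (pp. 39–40)]
[cite: Voisin2002, Cor. 6.14] -/
theorem IsCMTypeRealisation.not_mem_of_isOfHodgeType_zeroOne (h : IsCMTypeRealisation Φ A ι θ) {τ : K →+* ℂ}
    {v : complexBetti A.X 1} (hv : v ∈ eigenline θ τ) (hv0 : v ≠ 0)
    (h01 : IsOfHodgeType (Module.finrank ℚ K / 2) A.X 1 0 1 v) : τ ∉ Φ.1 := by
  intro hτ
  have h10 : IsOfHodgeType (Module.finrank ℚ K / 2) A.X 1 1 0 v := (h.2.2.2 τ).2.1 hτ v hv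
  exact hv0 (IsOfHodgeType.eq_zero_of_ne h.1 h10 h01 (by decide))

/-- For `τ ∈ Φ`, EVERY `τ`-eigenvector is of type `(1,0)` (restatement of the realisation clause, for symmetry of use).
[cite: Shimura1998, §5.2 (pp. 39–40)] -/
theorem IsCMTypeRealisation.isOfHodgeType_oneZero_of_mem (h : IsCMTypeRealisation Φ A ι θ) {τ : K →+* ℂ}
    (hτ : τ ∈ Φ.1) {v : complexBetti A.X 1} (hv : v ∈ eigenline θ τ) :
    IsOfHodgeType (Module.finrank ℚ K / 2) A.X 1 1 0 v :=
  (h.2.2.2 τ).2.1 hτ v hv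

end Literature.AlgebraicGeometry.ComplexMultiplication

/-! ## §2 Hodge type `(1,0)` on `H¹` read through a surjective homomorphism -/

namespace Literature.AlgebraicGeometry.Motives.AbelianVariety

/-- **Hodge type `(1,0)` is read through a surjective homomorphism of complex abelian varieties**: for `u : A → B`
surjective and `v ∈ H¹(B(ℂ); ℂ)`, `v` is of type `(1,0)` iff `u^* v` is — `u^*` is injective on `H¹`
([Voisin2002] Lemma 7.28) and injective pull-backs detect Hodge types. [cite: Voisin2002, Lemma 7.28]
[cite: Shimura1998, §5.2 (pp. 39–40)] -/
theorem isOfHodgeType_oneZero_iff_map_of_surjective {A B : AbelianVariety ℂ} (u : A ⟶ B)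
    (hu : AlgebraicGeometry.Surjective (AbelianVariety.Hom.toSchemeHom u)) (v : complexBetti B.X 1) :
    IsOfHodgeType B.dim B.X 1 1 0 v ↔ IsOfHodgeType A.dim A.X 1 1 0 (complexBetti.map u.hom.hom.hom 1 v) := by
  have hA : IsSmoothProjective A.dim A.X := AbelianVariety.isSmoothProjective_holds (A := A)
  have hB : IsSmoothProjective B.dim B.X := AbelianVariety.isSmoothProjective_holds (A := B)
  haveI : AlgebraicGeometry.Surjective u.hom.hom.hom.left := hu
  have hinj : Function.Injective (complexBetti.map u.hom.hom.hom 1) :=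
    complexBetti_map_injective_of_surjective hB hA u.hom.hom.hom 1
  constructor
  · intro hv
    exact hv.map_of_isSmoothProjective hA hB u.hom.hom.hom
  · intro hv
    exact IsOfHodgeType.of_map_of_injective hA hB u.hom.hom.hom (show 1 + 0 = 1 by norm_num) hinj hv

/-- The same for type `(0,1)`. [cite: Voisin2002, Lemma 7.28] -/
theorem isOfHodgeType_zeroOne_iff_map_of_surjective {A B : AbelianVariety ℂ} (u : A ⟶ B)
    (hu : AlgebraicGeometry.Surjective (AbelianVariety.Hom.toSchemeHom u)) (v : complexBetti B.X 1) :
    IsOfHodgeType B.dim B.X 1 0 1 v ↔ IsOfHodgeType A.dim A.X 1 0 1 (complexBetti.map u.hom.hom.hom 1 v) := by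
  have hA : IsSmoothProjective A.dim A.X := AbelianVariety.isSmoothProjective_holds (A := A)
  have hB : IsSmoothProjective B.dim B.X := AbelianVariety.isSmoothProjective_holds (A := B)
  haveI : AlgebraicGeometry.Surjective u.hom.hom.hom.left := hu
  have hinj : Function.Injective (complexBetti.map u.hom.hom.hom 1) :=
    complexBetti_map_injective_of_surjective hB hA u.hom.hom.hom 1
  constructor
  · intro hv
    exact hv.map_of_isSmoothProjective hA hB u.hom.hom.hom
  · intro hv
    exact IsOfHodgeType.of_map_of_injective hA hB u.hom.hom.hom (show 0 + 1 = 1 by norm_num) hinj hv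

end Literature.AlgebraicGeometry.Motives.AbelianVariety

/-! ## §3 The reflex type on an abstract `k ⊇ K*`: the CM dichotomy, and the type of `χ_τ` at the base place -/

namespace Literature.NumberTheory.ComplexMultiplication

variable (K : Type) [Field K] [NumberField K] [NumberField.IsCMField K] (Φ : CMType K) {k : Type} [Field k] [NumberField k]
  [Algebra k ℂ] [Algebra (traceField Φ) k] [IsScalarTower (traceField Φ) k ℂ]

omit [NumberField K] [NumberField.IsCMField K] in
/-- Conjugating twice gives the embedding back. [cite: Shimura1998, §13.1 (7)] -/
private theorem conjugate_conjugate_eq' {k' : Type} [Field k'] (σ : k' →+* ℂ) :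
    ComplexEmbedding.conjugate (ComplexEmbedding.conjugate σ) = σ :=
  RingHom.ext fun x => by simp

omit [NumberField K] [NumberField.IsCMField K] in
/-- `Aut(ℂ)` acting by complex conjugation on an embedding is the conjugate embedding. [cite: Shimura1998, §13.1 (7)] -/
theorem starRingAut_smul_eq_conjugate {k' : Type} [Field k'] (σ : k' →+* ℂ) :
    (starRingAut : ℂ ≃+* ℂ) • σ = ComplexEmbedding.conjugate σ :=
  RingHom.ext fun _ => rfl

omit [NumberField.IsCMField K] [NumberField k] [Algebra k ℂ] [IsScalarTower (traceField Φ) k ℂ] in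
/-- Restriction to `K*` commutes with the `Aut(ℂ)`-action. [cite: Shimura1998, §13.1 (7)] -/
theorem smul_comp_algebraMap_traceField (g : ℂ ≃+* ℂ) (σ : k →+* ℂ) :
    (g • σ).comp (algebraMap (traceField Φ) k) = g • σ.comp (algebraMap (traceField Φ) k) :=
  rfl

/-- **The CM dichotomy of the reflex type on an abstract number field `k ⊇ K*`**: `σ̄ ∈ Ψ_τ(k) ↔ σ ∉ Ψ_τ(k)` — the
intermediate-field form (★ `starRingAut_smul_mem_reflexTypeOn_iff` at `K*` itself) transported along the restriction
`σ ↦ σ|_{K*}` (★ `mem_reflexTypeOn_iff_comp_algebraMap_traceField_mem_of_isScalarTower`).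
[cite: MilneCM2006, Ch. I §1 Prop. 1.23] [cite: Shimura1998, §13.1 (7)] -/
theorem starRingAut_smul_mem_reflexTypeOn_iff_of_isScalarTower (τ : K →+* ℂ) (σ : k →+* ℂ) :
    (starRingAut : ℂ ≃+* ℂ) • σ ∈ reflexTypeOn Φ.1 τ (algebraMap k ℂ) ↔ σ ∉ reflexTypeOn Φ.1 τ (algebraMap k ℂ) := by
  rw [mem_reflexTypeOn_iff_comp_algebraMap_traceField_mem_of_isScalarTower K Φ τ,
    mem_reflexTypeOn_iff_comp_algebraMap_traceField_mem_of_isScalarTower K Φ τ σ, smul_comp_algebraMap_traceField,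
    starRingAut_smul_mem_reflexTypeOn_iff K Φ (traceField Φ) le_rfl τ]

/-- The conjugate-embedding form of the dichotomy: `σ̄ ∈ Ψ_τ(k) ↔ σ ∉ Ψ_τ(k)`. [cite: Shimura1998, §13.1 (7)] -/
theorem conjugate_mem_reflexTypeOn_iff (τ : K →+* ℂ) (σ : k →+* ℂ) :
    ComplexEmbedding.conjugate σ ∈ reflexTypeOn Φ.1 τ (algebraMap k ℂ) ↔ σ ∉ reflexTypeOn Φ.1 τ (algebraMap k ℂ) := by
  rw [← starRingAut_smul_eq_conjugate, starRingAut_smul_mem_reflexTypeOn_iff_of_isScalarTower K Φ τ σ]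

/-- For `τ ∈ Φ`, the base embedding lies in `Ψ_τ(k)` and its conjugate does not. [cite: Shimura1998, §13.1 (7)] -/
theorem algebraMap_mem_reflexTypeOn_and_conjugate_not_mem {τ : K →+* ℂ} (hτ : τ ∈ Φ.1) :
    algebraMap k ℂ ∈ reflexTypeOn Φ.1 τ (algebraMap k ℂ) ∧
      ComplexEmbedding.conjugate (algebraMap k ℂ) ∉ reflexTypeOn Φ.1 τ (algebraMap k ℂ) := by
  refine ⟨self_mem_reflexTypeOn _ hτ, fun h => ?_⟩
  exact ((conjugate_mem_reflexTypeOn_iff K Φ τ _).1 h) (self_mem_reflexTypeOn _ hτ)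

/-- **The infinity type of `χ_τ` at the place of the base embedding, `τ ∈ Φ`: `(p_w, q_w) = (1, 0)`** when
`w.embedding = algebraMap k ℂ` ([Shimura1998] (19.10a): `p_w = [σ_w ∈ Ψ_τ]`, `q_w = [σ̄_w ∈ Ψ_τ]`).
[cite: Shimura1998, Prop. 19.10 (19.10a)] -/
theorem cmInfinityType_eq_one_zero_of_mem {τ : K →+* ℂ} (hτ : τ ∈ Φ.1) (w : InfinitePlace k)
    (hw : w.embedding = algebraMap k ℂ) :
    (cmInfinityType Φ.1 τ (algebraMap k ℂ)).1 w = 1 ∧ (cmInfinityType Φ.1 τ (algebraMap k ℂ)).2 w = 0 := by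
  obtain ⟨hmem, hnot⟩ := algebraMap_mem_reflexTypeOn_and_conjugate_not_mem K Φ (k := k) hτ
  have hwc : ¬w.IsReal := by
    rw [InfinitePlace.isReal_iff, hw]
    intro hreal
    apply hnot
    rw [ComplexEmbedding.isReal_iff.1 hreal]
    exact hmem
  refine ⟨?_, ?_⟩
  · rw [cmInfinityType_fst, hw, Set.indicator_of_mem hmem]
  · rw [cmInfinityType_snd, if_neg hwc, hw, Set.indicator_of_notMem hnot]

/-- **… and `(p_w, q_w) = (0, 1)`** when `w.embedding` is the CONJUGATE of the base embedding.
[cite: Shimura1998, Prop. 19.10 (19.10a)] -/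
theorem cmInfinityType_eq_zero_one_of_mem {τ : K →+* ℂ} (hτ : τ ∈ Φ.1) (w : InfinitePlace k)
    (hw : w.embedding = ComplexEmbedding.conjugate (algebraMap k ℂ)) :
    (cmInfinityType Φ.1 τ (algebraMap k ℂ)).1 w = 0 ∧ (cmInfinityType Φ.1 τ (algebraMap k ℂ)).2 w = 1 := by
  obtain ⟨hmem, hnot⟩ := algebraMap_mem_reflexTypeOn_and_conjugate_not_mem K Φ (k := k) hτ
  have hwc : ¬w.IsReal := by
    rw [InfinitePlace.isReal_iff, hw]
    intro hreal
    apply hnot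
    have h := ComplexEmbedding.isReal_iff.1 hreal
    rw [conjugate_conjugate_eq'] at h
    rw [← h]
    exact hmem
  refine ⟨?_, ?_⟩
  · rw [cmInfinityType_fst, hw, Set.indicator_of_notMem hnot]
  · rw [cmInfinityType_snd, if_neg hwc, hw, conjugate_conjugate_eq', Set.indicator_of_mem hmem]

/-- **Every infinite place of `k` reads `χ_τ` (`τ ∈ Φ`) with type `(1,0)` or `(0,1)`** — the place of `σ₀` or of `σ̄₀`
decides; for the place `w₀ = mk σ₀` of the base embedding itself one of the two previous lemmas applies
(Mathlib `NumberField.InfinitePlace.mk_embedding`: `(mk φ).embedding = φ ∨ = conjugate φ` through `mk_eq_iff`).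
[cite: Shimura1998, Prop. 19.10 (19.10a)] -/
theorem cmInfinityType_mk_algebraMap_of_mem {τ : K →+* ℂ} (hτ : τ ∈ Φ.1) :
    ((cmInfinityType Φ.1 τ (algebraMap k ℂ)).1 (InfinitePlace.mk (algebraMap k ℂ)) = 1 ∧
        (cmInfinityType Φ.1 τ (algebraMap k ℂ)).2 (InfinitePlace.mk (algebraMap k ℂ)) = 0) ∨
      ((cmInfinityType Φ.1 τ (algebraMap k ℂ)).1 (InfinitePlace.mk (algebraMap k ℂ)) = 0 ∧
        (cmInfinityType Φ.1 τ (algebraMap k ℂ)).2 (InfinitePlace.mk (algebraMap k ℂ)) = 1) := by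
  have h : InfinitePlace.mk (InfinitePlace.mk (algebraMap k ℂ)).embedding = InfinitePlace.mk (algebraMap k ℂ) :=
    InfinitePlace.mk_embedding _
  rcases InfinitePlace.mk_eq_iff.1 h with h1 | h1
  · exact Or.inl (cmInfinityType_eq_one_zero_of_mem K Φ hτ _ h1)
  · refine Or.inr (cmInfinityType_eq_zero_one_of_mem K Φ hτ _ ?_)
    have h2 := congrArg ComplexEmbedding.conjugate h1
    rwa [conjugate_conjugate_eq'] at h2

end Literature.NumberTheory.ComplexMultiplication
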